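import Mathlib.Data.Nat.Choose.Basic
import Mathlib.Algebra.BigOperators.Intervals
import Mathlib.Algebra.Order.BigOperators.Group.Finset
import Mathlib.Tactic
import Summits.CriticalPhenomena.PercolationContinuityZ3.Theorems.PercNearOneGluingNoHeavyLowerTailULCKappa
import HarnessLib

/-!
# THEOREM U-LC two steps off the centre (`j = 2`): log-concavity of `C(L,t) + C(L,t-2)`

Support file for the Sahi / Conjecture-P programme of route `PercNearOneGluingNoHeavy`
(`--supports stmt-CriticalPhenomena-4575`, prover prim-l12-p5 gen 28; proof note
`prim-l12-p5/U-STRUCTURE-g28.md` §3, §6(5)).  No definitions, no named facts, no sorries.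

`ULCKappa.u_lc_kappa` proves CONJECTURE U (hence TEST(j)) for all symmetric unimodal tilts under the
hypothesis that the two-bump sequence `Φ_j(t) = C(L,t) + C(L,t-j)` is two-point log-concave (true iff
`j² ≤ L+3`).  For `j = 2` this needs `L ≥ 1`, and then `Φ_2(t) = ∑_{s<4} C(L-1,t-s)` is a WINDOW SUM of the
log-concave sequence `C(L-1,·)` (because `(1+x²)(1+x) = 1+x+x²+x³`).  This file proves

* `nested_le` : for a nonnegative two-point log-concave `a`, a nested pair has the larger product:
  `x ≤ p, q ≤ y`, `p + q = x + y` ⟹ `a x · a y ≤ a p · a q`;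
* `window_succ`, `window_lc2` : window sums `W(t) = ∑_{s≤w'} a(t-s)` of such an `a` are two-point log-concave;
* `phi_two_eq_window`, `phi_lc2_two` : `Φ_2` for `L ≥ 1` is a window sum of `C(L-1,·)`, hence two-point
  log-concave;
* `u_lc_kappa_two` : **THEOREM U-LC for `j = 2`, unconditional**: for `2K + 2 = M₁+M₂+L` with `L ≥ 1`,
  `κ ≥ 0`, `κN(N-1) ≥ M₁M₂(N-4)` and all symmetric unimodal tilts, the tilted two-block sum is `≥ 0`
  (the tilted TEST(2) inequality; new beyond the flat/binomial cases).
-/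

namespace Summit.CriticalPhenomena.PercolationContinuityZ3.Theorems

namespace ULCTwo

open Finset

/-! ### Nested pairs and window sums of a two-point log-concave sequence -/

/-- For `a ≥ 0` two-point log-concave and a nested pair `x ≤ p`, `x ≤ q`, `p + q = x + y` (so `p, q ≤ y`):
`a x · a y ≤ a p · a q`.  (Iterated two-point log-concavity.) -/
theorem nested_le (a : ℕ → ℝ)
    (hlc : ∀ m m', m ≤ m' → a m * a (m' + 1) ≤ a (m + 1) * a m') :
    ∀ d x y p q : ℕ, p = x + d → x ≤ q → p + q = x + y → a x * a y ≤ a p * a q := by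
  intro d
  induction d with
  | zero =>
    intro x y p q hp hxq hsum
    have hpx : p = x := by omega
    have hqy : q = y := by omega
    rw [hpx, hqy]
  | succ d ih =>
    intro x y p q hp hxq hsum
    -- compare (x, y) with (x+1, y-1), then induct
    rcases Nat.lt_or_ge x q with hlt | hge
    · -- x < q: y ≥ p ≥ x + 1, use two-point LC at (x, y-1)
      have hy : 1 ≤ y := by omega
      have h1 : a x * a y ≤ a (x + 1) * a (y - 1) := by
        have := hlc x (y - 1) (by omega)
        have e : y - 1 + 1 = y := by omega
        rw [e] at this
        exact this
      have h2 : a (x + 1) * a (y - 1) ≤ a p * a q :=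
        ih (x + 1) (y - 1) p q (by omega) (by omega) (by omega)
      exact le_trans h1 h2
    · -- x = q: then p = y, equality
      have hxq' : x = q := le_antisymm hxq hge
      have hpy : p = y := by omega
      rw [hxq', hpy, mul_comm]

/-- Window step: `W(t+1) = W(t) + a(t+1) - a(t-w')` (the last term read as `0` if `t < w'`), where
`W(t) = ∑_{s ≤ w'} a(t-s)` is the window sum of width `w'+1` (terms with `s > t` read as `0`). -/
theorem window_succ (a : ℕ → ℝ) (w' t : ℕ) :
    ∑ s ∈ range (w' + 1), (if s ≤ t + 1 then a (t + 1 - s) else 0) =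
      (∑ s ∈ range (w' + 1), (if s ≤ t then a (t - s) else 0)) + a (t + 1) -
        (if w' ≤ t then a (t - w') else 0) := by
  rw [sum_range_succ' (fun s => if s ≤ t + 1 then a (t + 1 - s) else 0) w', sum_range_succ]
  have e : ∀ s ∈ range w', (if s + 1 ≤ t + 1 then a (t + 1 - (s + 1)) else 0) =
      (if s ≤ t then a (t - s) else 0) := by
    intro s _
    by_cases hs : s ≤ t
    · rw [if_pos (by omega), if_pos hs]
      congr 1
      omega
    · rw [if_neg (by omega), if_neg hs]
  rw [sum_congr rfl e, if_pos (Nat.zero_le _), Nat.sub_zero]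
  ring

/-- **Window sums of a two-point log-concave nonnegative sequence are two-point log-concave**
(window of width `w'+1`). -/
theorem window_lc2 (a : ℕ → ℝ) (ha : ∀ t, 0 ≤ a t)
    (hlc : ∀ m m', m ≤ m' → a m * a (m' + 1) ≤ a (m + 1) * a m') (w' : ℕ) (m m' : ℕ) (hmm' : m ≤ m') :
    (∑ s ∈ range (w' + 1), (if s ≤ m then a (m - s) else 0)) *
        (∑ s ∈ range (w' + 1), (if s ≤ m' + 1 then a (m' + 1 - s) else 0)) ≤
      (∑ s ∈ range (w' + 1), (if s ≤ m + 1 then a (m + 1 - s) else 0)) *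
        (∑ s ∈ range (w' + 1), (if s ≤ m' then a (m' - s) else 0)) := by
  set Wm := ∑ s ∈ range (w' + 1), (if s ≤ m then a (m - s) else 0) with hWm
  set Wm' := ∑ s ∈ range (w' + 1), (if s ≤ m' then a (m' - s) else 0) with hWm'
  rw [window_succ a w' m', window_succ a w' m]
  have hWm0 : 0 ≤ Wm := sum_nonneg fun s _ => by split_ifs <;> simp [ha]
  have hWm'0 : 0 ≤ Wm' := sum_nonneg fun s _ => by split_ifs <;> simp [ha]
  -- (i)  Wm · a(m'+1) ≤ Wm' · a(m+1)
  have h1 : Wm * a (m' + 1) ≤ Wm' * a (m + 1) := by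
    rw [hWm, hWm', sum_mul, sum_mul]
    refine sum_le_sum fun s _ => ?_
    by_cases hsm : s ≤ m
    · rw [if_pos hsm, if_pos (by omega)]
      have := nested_le a hlc (s + 1) (m - s) (m' + 1) (m + 1) (m' - s) (by omega) (by omega) (by omega)
      linarith [this]
    · rw [if_neg hsm, zero_mul]
      split_ifs
      · exact mul_nonneg (ha _) (ha _)
      · simp
  -- (ii) Wm' · a(m-w') ≤ Wm · a(m'-w')  (when w' ≤ m)
  have h2 : Wm' * (if w' ≤ m then a (m - w') else 0) ≤
      Wm * (if w' ≤ m' then a (m' - w') else 0) := by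
    by_cases hwm : w' ≤ m
    · rw [if_pos hwm, if_pos (by omega), hWm, hWm', sum_mul, sum_mul]
      refine sum_le_sum fun s hs => ?_
      have hsw : s < w' + 1 := mem_range.mp hs
      rw [if_pos (by omega), if_pos (by omega)]
      -- the pair (m'-s, m-w') contains the pair (m-s, m'-w')
      have := nested_le a hlc (w' - s) (m - w') (m' - s) (m - s) (m' - w')
        (by omega) (by omega) (by omega)
      linarith [this]
    · rw [if_neg hwm, mul_zero]
      refine mul_nonneg hWm0 ?_
      split_ifs
      · exact ha _
      · exact le_rfl
  nlinarith [h1, h2, hWm0, hWm'0, ha (m + 1), ha (m' + 1)]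

/-! ### `Φ_2` is a window sum -/

/-- For `L ≥ 1`: `Φ_2(t) = C(L,t) + C(L,t-2) = ∑_{s<4} C(L-1, t-s)`. -/
theorem phi_two_eq_window (L' t : ℕ) :
    ((L' + 1).choose t : ℝ) + (if 2 ≤ t then ((L' + 1).choose (t - 2) : ℝ) else 0) =
      ∑ s ∈ range (3 + 1), (if s ≤ t then (L'.choose (t - s) : ℝ) else 0) := by
  simp only [sum_range_succ, sum_range_zero, zero_add, Nat.zero_le, if_true, Nat.sub_zero]
  -- C(L'+1,t) = C(L',t) + C(L',t-1) and C(L'+1,t-2) = C(L',t-2) + C(L',t-3)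
  rcases Nat.lt_or_ge t 1 with h0 | h1
  · have ht : t = 0 := by omega
    subst ht
    simp
  rcases Nat.lt_or_ge t 2 with h1' | h2
  · have ht : t = 1 := by omega
    subst ht
    simp
  rcases Nat.lt_or_ge t 3 with h2' | h3
  · have ht : t = 2 := by omega
    subst ht
    norm_num [Nat.choose_succ_succ', Nat.choose_zero_right]
    ring
  · obtain ⟨r, rfl⟩ : ∃ r, t = r + 3 := ⟨t - 3, by omega⟩
    rw [if_pos (by omega), if_pos (by omega), if_pos (by omega), if_pos (by omega)]
    have e2 : r + 3 - 2 = (r) + 1 := by omega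
    have e3 : r + 3 - 1 = r + 2 := by omega
    have e4 : r + 3 - 3 = r := by omega
    rw [e2, e3, e4]
    rw [show r + 3 = (r + 2) + 1 by ring, Nat.choose_succ_succ' L' (r + 2), Nat.choose_succ_succ' L' r]
    push_cast
    ring

/-- `Φ_2` is two-point log-concave for `L ≥ 1`. -/
theorem phi_lc2_two (L : ℕ) (hL : 1 ≤ L) (m m' : ℕ) (h : m ≤ m') :
    ((L.choose m : ℝ) + (if 2 ≤ m then (L.choose (m - 2) : ℝ) else 0)) *
        ((L.choose (m' + 1) : ℝ) + (if 2 ≤ m' + 1 then (L.choose (m' + 1 - 2) : ℝ) else 0)) ≤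
      ((L.choose (m + 1) : ℝ) + (if 2 ≤ m + 1 then (L.choose (m + 1 - 2) : ℝ) else 0)) *
        ((L.choose m' : ℝ) + (if 2 ≤ m' then (L.choose (m' - 2) : ℝ) else 0)) := by
  obtain ⟨L', rfl⟩ : ∃ L', L = L' + 1 := ⟨L - 1, by omega⟩
  rw [phi_two_eq_window L' m, phi_two_eq_window L' (m' + 1), phi_two_eq_window L' (m + 1),
    phi_two_eq_window L' m']
  exact window_lc2 (fun t => (L'.choose t : ℝ)) (fun t => by positivity)
    (fun a b hab => TwoLevel.choose_lc2 L' a b hab) 3 m m' h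

/-- **THEOREM U-LC for `j = 2` (unconditional).**  Let `2K + 2 = M₁ + M₂ + L` with `L ≥ 1`, `κ ≥ 0` with
`κ N(N-1) ≥ M₁M₂(N-4)` (`N = M₁+M₂+L`; i.e. `κ ≥ M₁M₂(N-4)₊/(N(N-1))`, the constant of CONJECTURE U at
`j = 2`), and `w₁, w₂ ≥ 0` symmetric unimodal.  Then
`∑ C(M₁,x₁)w₁(x₁)C(M₂,x₂)w₂(x₂)C(L,K-x₁-x₂)(κ + (2x₁-M₁)(2x₂-M₂)) ≥ 0` — CONJECTURE U two steps off the
centre, hence TEST(2) for every pair of symmetric unimodal tilts with at least one buffer coin. -/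
theorem u_lc_kappa_two (M₁ M₂ L K : ℕ) (hL : 1 ≤ L) (hN : 2 * K + 2 = M₁ + M₂ + L) (κ : ℝ) (hκ : 0 ≤ κ)
    (hκ₀ : (M₁ : ℝ) * M₂ * (((M₁ + M₂ + L : ℕ) : ℝ) - (((M₁ + M₂ + L : ℕ) : ℝ) - 2 * K) ^ 2) ≤
      κ * (((M₁ + M₂ + L : ℕ) : ℝ) * (((M₁ + M₂ + L : ℕ) : ℝ) - 1)))
    (w₁ w₂ : ℕ → ℝ) (hw₁nn : ∀ x, 0 ≤ w₁ x)
    (hw₁sym : ∀ x, x ≤ M₁ → w₁ x = w₁ (M₁ - x)) (hw₁uni : ∀ x, 2 * x + 2 ≤ M₁ → w₁ x ≤ w₁ (x + 1))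
    (hw₂nn : ∀ x, 0 ≤ w₂ x)
    (hw₂sym : ∀ x, x ≤ M₂ → w₂ x = w₂ (M₂ - x)) (hw₂uni : ∀ x, 2 * x + 2 ≤ M₂ → w₂ x ≤ w₂ (x + 1)) :
    0 ≤ ∑ x₁ ∈ range (M₁ + 1), ∑ x₂ ∈ range (M₂ + 1),
        (M₁.choose x₁ : ℝ) * w₁ x₁ * ((M₂.choose x₂ : ℝ) * w₂ x₂) *
          (if x₁ + x₂ ≤ K then (L.choose (K - (x₁ + x₂)) : ℝ) else 0) *
          (κ + (2 * (x₁ : ℝ) - M₁) * (2 * (x₂ : ℝ) - M₂)) :=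
  ULCKappa.u_lc_kappa M₁ M₂ L K 2 hN κ hκ hκ₀ w₁ w₂ hw₁nn hw₁sym hw₁uni hw₂nn hw₂sym hw₂uni
    (fun m m' h => phi_lc2_two L hL m m' h)

end ULCTwo

end Summit.CriticalPhenomena.PercolationContinuityZ3.Theorems
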